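import Mathlib
import HarnessLib

/-!
# Route `KLProgramme` — crux K3 ENGINE (stmt-HubbardSuperconductivity-20437 `KLRegimeEngineV17F2`), stub (b) v2, THE LEVELS PACKAGE (ℓ):
# instantiation (I5), THE NUMERICS — the kit's numerical side conditions from the blocking row, two amplitude rows and ONE explicit λ-threshold
# (E1-LEVELS-BLUEPRINT-g8 §3 (I5) / §6 step 5 «pure real arithmetic, can be typed in parallel by any seat from the kit's hypothesis list»;
#  E1-TOWER-BLOCKED §4 «constant structure and the order of choices g → Q → B → ε»; cell gate-hubbard-kl, seat hubbard-kl-k3c3-p2 g13, located «(ℓ)-NUMERICS»)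

The blocked-tower inductions `towerBorn_le_law_split` (part 9, `…EngineTowerBookkeepingSplit`) and `towerBorn_le_law_tracks` (part 9′,
`…EngineTowerBookkeepingTracks`) carry — besides the model data `b, μ` with their UV / re-measurement / import / step hypotheses — a block of
purely NUMERICAL side conditions on the constants `(σ Φ ψ τ; A Q; A' Q'; ι₁ ι₂ ι₃; lam)`, identical in both files:
`hQ'ge` (`c₂·g·Q ≤ Q'`, per track `c₂ r^a Q ≤ Q'`), `hu₁ hu₂` (`4Q' ≤ Q`, `2τψQ' ≤ Q`), `hx₁ hx₂ hx₃` (`4σλQ' < 1`, `2λτQ' ≤ 1`, `eτλQ' < 1`),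
`hy` (`Φ·(τ·Y) < 1`, `Y := ι₁λ + ι₂/(2Q') + ι₃/(4Q'²) + A'Q'/4`), `hθ` (the second geometric ratio `< 1`) and `hclose` (the closing inequality
`A'(4Q')³·x/(1−x) + e·ψ·(2τψQ')²·(τY)·(ΦτY/(1−ΦτY)) ≤ A·Q³`, `x := 4σλQ'`).  (`hA'ge`, `hι₃ge` are definitions of `A'`, `ι₃` and need no lemma.)

This file discharges them from THREE elementary inputs, token-for-token in the kit's expressions:

* §1 **the blocking row** — with the choice `Q' := Q / max 4 (2τψ)`: `0 < Q'`, `hu₁`, `hu₂`, and `hQ'ge` from `c₂·g·max 4 (2τψ) ≤ 1`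
  (E1-TOWER-BLOCKED §2/§4 (i): the block length `d` is chosen to make this hold);
* §3 **six λ-linear smallness rows** `(s0)–(s6)` (`λ ≤ 1`, `8σQ'λ ≤ 1`, `2eτQ'λ ≤ 1`, `4Φτι₁λ ≤ 1`, `Φ·W·λ ≤ 1/2`, `16σQ'A'(4Q')³λ ≤ AQ³`,
  `16eψ(2τψQ')²Φτ²ι₁²λ ≤ AQ³`; `W := eτι₁ + (eτ)²ι₂ + (eτ)³ι₃ + A'(eτQ')²/2`) together with **two amplitude rows** on the λ-FREE part
  `Y₀ := ι₂/(2Q') + ι₃/(4Q'²) + A'Q'/4` of `Y` — (N1) `Φ·(τ·Y₀) ≤ 1/4`, (N2) `16·e·ψ·(2τψQ')²·Φ·τ²·Y₀² ≤ A·Q³` (§4 (ii)/(iii) of the memo: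
  «`y < 1/2` ⇔ the amplitude `A·Q` small», «`ι₂/λ` small» — the rows the choice of `(Qd, B)` must meet) ⟹ `hx₁ ∧ hx₂ ∧ hx₃ ∧ hy ∧ hθ ∧ hclose`
  (`towerNumerics_side_of_rows`);
* §4 **ONE explicit threshold**: `(s0)–(s6)` follow from `λ ≤ towerLamThreshold-expression` = a seven-entry `min`-chain of positive closed forms
  (`towerNumerics_rows_of_lam_le`, positivity `towerNumerics_threshold_pos`) — the shape (I5)'s `klTowerLevelsU` needs (§4 (iv): `λ = B·ε_j ≤ λ₀`
  is the engine's `U₀`/`c₃` door); master form `towerNumerics_side_of_lam_le`;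
* §5 **the amplitude rows from four one-line smallness rows** in the kit's forced parametrisation `A' = C_A·A`, `ι₃ = C₃·A·Q³`, `Q' = Q/ρ`
  (`towerNumerics_amplitude_of_rows`): with `w := ι₂/Q`, `X := A·Q`, `K := C₃ρ²/4 + C_A/(4ρ)` they read `Φτρw ≤ 1/4`, `ΦτKX ≤ 1/8`,
  `64eψ³Φτ⁴w² ≤ X`, `256eψ³Φτ⁴K²X ≤ ρ²` — small import-to-scale ratio `w`, small amplitude `X` bounded below by `w²`: the memo's order of choices.

Pure real arithmetic; nothing about the model is asserted; nothing asserts any stub, (ℓ), K3 or superconductivity.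
References: Benfatto–Giuliani–Mastropietro 2006 §2.8 (2.83), §3 (3.2)–(3.8) [cite: BenfattoGiulianiMastropietro2006]; Gawȩdzki–Kupiainen 1985 §3.
-/

noncomputable section

namespace Summit.HubbardSuperconductivity.HubbardSuperconductivity.Theorems.EngineV8

set_option linter.dupNamespace false -- summit = problem name (single-conjunct summit), D-0017

open Real

/-! ## §1 The blocking row: `Q' := Q / max 4 (2τψ)` -/

/-- `0 < max 4 (2τψ)`. -/
theorem towerNumerics_rho_pos (τ ψ : ℝ) : 0 < max 4 (2 * τ * ψ) :=
  lt_of_lt_of_le (by norm_num) (le_max_left _ _)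

/-- `Q' := Q / max 4 (2τψ)` is positive for `Q > 0` (the kit's `hQ'0`). -/
theorem towerNumerics_Q'_pos {Q : ℝ} (τ ψ : ℝ) (hQ : 0 < Q) : 0 < Q / max 4 (2 * τ * ψ) :=
  div_pos hQ (towerNumerics_rho_pos τ ψ)

/-- The kit's `hu₁`: `4·Q' ≤ Q` for `Q' := Q / max 4 (2τψ)`. -/
theorem towerNumerics_hu₁ {Q : ℝ} (τ ψ : ℝ) (hQ : 0 ≤ Q) : 4 * (Q / max 4 (2 * τ * ψ)) ≤ Q := by
  have hρ := towerNumerics_rho_pos τ ψ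
  rw [mul_div_assoc', div_le_iff₀ hρ]
  exact mul_comm 4 Q ▸ mul_le_mul_of_nonneg_left (le_max_left _ _) hQ

/-- The kit's `hu₂`: `2τψ·Q' ≤ Q` for `Q' := Q / max 4 (2τψ)`. -/
theorem towerNumerics_hu₂ {Q : ℝ} (τ ψ : ℝ) (hQ : 0 ≤ Q) : 2 * τ * ψ * (Q / max 4 (2 * τ * ψ)) ≤ Q := by
  have hρ := towerNumerics_rho_pos τ ψ
  rw [mul_div_assoc', div_le_iff₀ hρ]
  exact mul_comm (2 * τ * ψ) Q ▸ mul_le_mul_of_nonneg_left (le_max_right _ _) hQ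

/-- The kit's `hQ'ge` from the BLOCKING row: `c·max 4 (2τψ) ≤ 1 ⟹ c·Q ≤ Q'` (`c = c₂·g`, or per track `c = c₂ₜ·rₜ^{aₜ}`). -/
theorem towerNumerics_hQ'ge {Q c : ℝ} (τ ψ : ℝ) (hQ : 0 ≤ Q) (hblock : c * max 4 (2 * τ * ψ) ≤ 1) :
    c * Q ≤ Q / max 4 (2 * τ * ψ) := by
  have hρ := towerNumerics_rho_pos τ ψ
  rw [le_div_iff₀ hρ]
  calc c * Q * max 4 (2 * τ * ψ) = Q * (c * max 4 (2 * τ * ψ)) := by ring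
    _ ≤ Q * 1 := mul_le_mul_of_nonneg_left hblock hQ
    _ = Q := mul_one Q

/-! ## §2 Two elementary inequalities -/

/-- Threshold algebra: `0 ≤ a`, `0 < c`, `0 ≤ λ ≤ c/(a+c) ⟹ a·λ ≤ c`. -/
theorem towerNumerics_mul_le_of_le_div {a c lam : ℝ} (ha : 0 ≤ a) (hc : 0 < c) (h : lam ≤ c / (a + c)) : a * lam ≤ c := by
  have hac : 0 < a + c := by positivity
  calc a * lam ≤ a * (c / (a + c)) := mul_le_mul_of_nonneg_left h ha
    _ ≤ c := by
      rw [mul_div_assoc', div_le_iff₀ hac]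
      nlinarith

/-- Geometric ratio at `x ≤ 1/2`: `x/(1−x) ≤ 2x`. -/
theorem towerNumerics_div_one_sub_le {x : ℝ} (hx0 : 0 ≤ x) (hx1 : x ≤ 1 / 2) : x / (1 - x) ≤ 2 * x := by
  rw [div_le_iff₀ (by linarith)]
  nlinarith

/-! ## §3 The six λ-dependent side conditions from the rows `(s0)–(s6)` and the amplitude rows `(N1)`, `(N2)` -/

section Rows

variable {σ Φ ψ τ A A' Q Q' ι₁ ι₂ ι₃ lam : ℝ}

/-- `hx₁`: `8σQ'λ ≤ 1 ⟹ 4σλQ' < 1`. -/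
theorem towerNumerics_hx₁ (s1 : 8 * σ * Q' * lam ≤ 1) : 4 * σ * lam * Q' < 1 := by
  have : 4 * σ * lam * Q' = (8 * σ * Q' * lam) / 2 := by ring
  rw [this]; linarith

/-- `hx₂`: `2eτQ'λ ≤ 1 ⟹ 2λτQ' ≤ 1` (`e ≥ 2`). -/
theorem towerNumerics_hx₂ (hτ : 0 ≤ τ) (hQ' : 0 ≤ Q') (hlam : 0 ≤ lam) (s2 : 2 * exp 1 * τ * Q' * lam ≤ 1) : 2 * lam * τ * Q' ≤ 1 := by
  have he : (1 : ℝ) + 1 ≤ exp 1 := Real.add_one_le_exp 1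
  have h0 : 0 ≤ τ * Q' * lam := by positivity
  nlinarith

/-- `hx₃`: `2eτQ'λ ≤ 1 ⟹ eτλQ' < 1`. -/
theorem towerNumerics_hx₃ (s2 : 2 * exp 1 * τ * Q' * lam ≤ 1) : exp 1 * τ * lam * Q' < 1 := by
  have : exp 1 * τ * lam * Q' = (2 * exp 1 * τ * Q' * lam) / 2 := by ring
  rw [this]; linarith

/-- `hy`: `4Φτι₁λ ≤ 1` and (N1) `Φ·(τ·Y₀) ≤ 1/4` ⟹ `Φ·(τ·Y) < 1`. -/
theorem towerNumerics_hy (s3 : 4 * Φ * τ * ι₁ * lam ≤ 1)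
    (N1 : Φ * (τ * (ι₂ / (2 * Q') + ι₃ / (4 * Q' ^ 2) + A' * Q' / 4)) ≤ 1 / 4) :
    Φ * (τ * (ι₁ * lam + ι₂ / (2 * Q') + ι₃ / (4 * Q' ^ 2) + A' * Q' / 4)) < 1 := by
  have : Φ * (τ * (ι₁ * lam + ι₂ / (2 * Q') + ι₃ / (4 * Q' ^ 2) + A' * Q' / 4)) =
      (4 * Φ * τ * ι₁ * lam) / 4 + Φ * (τ * (ι₂ / (2 * Q') + ι₃ / (4 * Q' ^ 2) + A' * Q' / 4)) := by ring
  rw [this]; linarith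

/-- `hθ`: `λ ≤ 1`, `2eτQ'λ ≤ 1` and `Φ·W·λ ≤ 1/2` (`W := eτι₁ + (eτ)²ι₂ + (eτ)³ι₃ + A'(eτQ')²/2`) ⟹ the kit's second ratio `< 1`
(`z := eτλQ' ≤ 1/2` gives `z³/(1−z) ≤ z/2`, and `λ² ≤ λ`). -/
theorem towerNumerics_hθ (hΦ : 0 ≤ Φ) (hτ : 0 ≤ τ) (hA' : 0 ≤ A') (hQ' : 0 ≤ Q') (hι₃ : 0 ≤ ι₃) (hlam : 0 ≤ lam) (s0 : lam ≤ 1)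
    (s2 : 2 * exp 1 * τ * Q' * lam ≤ 1)
    (s4 : Φ * (exp 1 * τ * ι₁ + (exp 1 * τ) ^ 2 * ι₂ + (exp 1 * τ) ^ 3 * ι₃ + A' * (exp 1 * τ * Q') ^ 2 / 2) * lam ≤ 1 / 2) :
    Φ * (exp 1 * τ * (ι₁ * lam) + (exp 1 * τ) ^ 2 * (ι₂ * lam) + (exp 1 * τ) ^ 3 * (ι₃ * lam ^ 2) +
      A' * (exp 1 * τ * Q') * ((exp 1 * τ * lam * Q') ^ 3 / (1 - exp 1 * τ * lam * Q'))) < 1 := by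
  set z := exp 1 * τ * lam * Q' with hz
  have hz0 : 0 ≤ z := by positivity
  have hz1 : z ≤ 1 / 2 := by have : z = (2 * exp 1 * τ * Q' * lam) / 2 := by rw [hz]; ring
                             rw [this]; linarith
  have hfrac : z ^ 3 / (1 - z) ≤ z / 2 := by
    rw [div_le_iff₀ (by linarith)]
    have hz2 : z * z ≤ 1 / 4 := by nlinarith
    nlinarith [mul_nonneg hz0 hz0, mul_nonneg hz0 (mul_nonneg hz0 hz0)]
  have h4 : A' * (exp 1 * τ * Q') * (z ^ 3 / (1 - z)) ≤ A' * (exp 1 * τ * Q') ^ 2 / 2 * lam := by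
    calc A' * (exp 1 * τ * Q') * (z ^ 3 / (1 - z)) ≤ A' * (exp 1 * τ * Q') * (z / 2) :=
          mul_le_mul_of_nonneg_left hfrac (by positivity)
      _ = A' * (exp 1 * τ * Q') ^ 2 / 2 * lam := by rw [hz]; ring
  have h3 : (exp 1 * τ) ^ 3 * (ι₃ * lam ^ 2) ≤ (exp 1 * τ) ^ 3 * ι₃ * lam := by
    have hl : lam ^ 2 ≤ lam := by nlinarith
    calc (exp 1 * τ) ^ 3 * (ι₃ * lam ^ 2) ≤ (exp 1 * τ) ^ 3 * (ι₃ * lam) := by gcongr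
      _ = (exp 1 * τ) ^ 3 * ι₃ * lam := by ring
  have hsum : exp 1 * τ * (ι₁ * lam) + (exp 1 * τ) ^ 2 * (ι₂ * lam) + (exp 1 * τ) ^ 3 * (ι₃ * lam ^ 2) +
      A' * (exp 1 * τ * Q') * (z ^ 3 / (1 - z)) ≤
      (exp 1 * τ * ι₁ + (exp 1 * τ) ^ 2 * ι₂ + (exp 1 * τ) ^ 3 * ι₃ + A' * (exp 1 * τ * Q') ^ 2 / 2) * lam := by
    have : (exp 1 * τ * ι₁ + (exp 1 * τ) ^ 2 * ι₂ + (exp 1 * τ) ^ 3 * ι₃ + A' * (exp 1 * τ * Q') ^ 2 / 2) * lam =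
        exp 1 * τ * (ι₁ * lam) + (exp 1 * τ) ^ 2 * (ι₂ * lam) + (exp 1 * τ) ^ 3 * ι₃ * lam + A' * (exp 1 * τ * Q') ^ 2 / 2 * lam := by
      ring
    rw [this]; linarith
  calc Φ * (exp 1 * τ * (ι₁ * lam) + (exp 1 * τ) ^ 2 * (ι₂ * lam) + (exp 1 * τ) ^ 3 * (ι₃ * lam ^ 2) +
        A' * (exp 1 * τ * Q') * (z ^ 3 / (1 - z)))
      ≤ Φ * ((exp 1 * τ * ι₁ + (exp 1 * τ) ^ 2 * ι₂ + (exp 1 * τ) ^ 3 * ι₃ + A' * (exp 1 * τ * Q') ^ 2 / 2) * lam) :=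
        mul_le_mul_of_nonneg_left hsum hΦ
    _ = Φ * (exp 1 * τ * ι₁ + (exp 1 * τ) ^ 2 * ι₂ + (exp 1 * τ) ^ 3 * ι₃ + A' * (exp 1 * τ * Q') ^ 2 / 2) * lam := by ring
    _ < 1 := by linarith

/-- `hclose`: the closing inequality from `(s0) (s1) (s3) (s5) (s6)` and the amplitude rows `(N1) (N2)`:
first term `≤ 8σQ'A'(4Q')³λ ≤ AQ³/2` (`x/(1−x) ≤ 2x` at `x = 4σλQ' ≤ 1/2`); second term `≤ 2eψ(2τψQ')²Φτ²Y²` (`u/(1−u) ≤ 2u` at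
`u = ΦτY ≤ 1/2`) with `Y² ≤ 2ι₁²λ + 2Y₀²` ⟹ `≤ AQ³/4 + AQ³/4`. -/
theorem towerNumerics_hclose (hσ : 0 ≤ σ) (hΦ : 0 ≤ Φ) (hψ : 0 ≤ ψ) (hτ : 0 ≤ τ) (hA' : 0 ≤ A') (hQ' : 0 ≤ Q')
    (hι₁ : 0 ≤ ι₁) (hι₂ : 0 ≤ ι₂) (hι₃ : 0 ≤ ι₃) (hlam : 0 ≤ lam) (s0 : lam ≤ 1)
    (s1 : 8 * σ * Q' * lam ≤ 1) (s3 : 4 * Φ * τ * ι₁ * lam ≤ 1)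
    (s5 : 16 * σ * Q' * A' * (4 * Q') ^ 3 * lam ≤ A * Q ^ 3)
    (s6 : 16 * exp 1 * ψ * (2 * τ * ψ * Q') ^ 2 * Φ * τ ^ 2 * ι₁ ^ 2 * lam ≤ A * Q ^ 3)
    (N1 : Φ * (τ * (ι₂ / (2 * Q') + ι₃ / (4 * Q' ^ 2) + A' * Q' / 4)) ≤ 1 / 4)
    (N2 : 16 * exp 1 * ψ * (2 * τ * ψ * Q') ^ 2 * Φ * τ ^ 2 * (ι₂ / (2 * Q') + ι₃ / (4 * Q' ^ 2) + A' * Q' / 4) ^ 2 ≤ A * Q ^ 3) :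
    A' * (4 * Q') ^ 3 * (4 * σ * lam * Q' / (1 - 4 * σ * lam * Q')) +
      exp 1 * ψ * (2 * τ * ψ * Q') ^ 2 * (τ * (ι₁ * lam + ι₂ / (2 * Q') + ι₃ / (4 * Q' ^ 2) + A' * Q' / 4)) *
        (Φ * (τ * (ι₁ * lam + ι₂ / (2 * Q') + ι₃ / (4 * Q' ^ 2) + A' * Q' / 4)) /
          (1 - Φ * (τ * (ι₁ * lam + ι₂ / (2 * Q') + ι₃ / (4 * Q' ^ 2) + A' * Q' / 4)))) ≤ A * Q ^ 3 := by
  -- first term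
  set x := 4 * σ * lam * Q' with hx
  have hx0 : 0 ≤ x := by positivity
  have hx1 : x ≤ 1 / 2 := by have : x = (8 * σ * Q' * lam) / 2 := by rw [hx]; ring
                             rw [this]; linarith
  have hT₁ : A' * (4 * Q') ^ 3 * (x / (1 - x)) ≤ A * Q ^ 3 / 2 :=
    calc A' * (4 * Q') ^ 3 * (x / (1 - x)) ≤ A' * (4 * Q') ^ 3 * (2 * x) :=
          mul_le_mul_of_nonneg_left (towerNumerics_div_one_sub_le hx0 hx1) (by positivity)
      _ = (16 * σ * Q' * A' * (4 * Q') ^ 3 * lam) / 2 := by rw [hx]; ring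
      _ ≤ A * Q ^ 3 / 2 := by linarith
  -- second term
  set Y₀ := ι₂ / (2 * Q') + ι₃ / (4 * Q' ^ 2) + A' * Q' / 4 with hY₀
  have hY₀0 : 0 ≤ Y₀ := by positivity
  set Y := ι₁ * lam + ι₂ / (2 * Q') + ι₃ / (4 * Q' ^ 2) + A' * Q' / 4 with hY
  have hYeq : Y = ι₁ * lam + Y₀ := by rw [hY, hY₀]; ring
  have hY0 : 0 ≤ Y := by rw [hYeq]; positivity
  set u := Φ * (τ * Y) with hu
  have hu0 : 0 ≤ u := by positivity
  have hu1 : u ≤ 1 / 2 := by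
    have : u = (4 * Φ * τ * ι₁ * lam) / 4 + Φ * (τ * Y₀) := by rw [hu, hYeq]; ring
    rw [this]; linarith
  have hsq : Y ^ 2 ≤ 2 * (ι₁ ^ 2 * lam) + 2 * Y₀ ^ 2 := by
    have h1 : Y ^ 2 ≤ 2 * (ι₁ * lam) ^ 2 + 2 * Y₀ ^ 2 := by rw [hYeq]; nlinarith [sq_nonneg (ι₁ * lam - Y₀)]
    have h2 : (ι₁ * lam) ^ 2 ≤ ι₁ ^ 2 * lam := by
      rw [mul_pow]; exact mul_le_mul_of_nonneg_left (by nlinarith) (sq_nonneg _)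
    linarith
  have hT₂ : exp 1 * ψ * (2 * τ * ψ * Q') ^ 2 * (τ * Y) * (u / (1 - u)) ≤ A * Q ^ 3 / 2 :=
    calc exp 1 * ψ * (2 * τ * ψ * Q') ^ 2 * (τ * Y) * (u / (1 - u))
        ≤ exp 1 * ψ * (2 * τ * ψ * Q') ^ 2 * (τ * Y) * (2 * u) :=
          mul_le_mul_of_nonneg_left (towerNumerics_div_one_sub_le hu0 hu1) (by positivity)
      _ = 2 * (exp 1 * ψ * (2 * τ * ψ * Q') ^ 2 * Φ * τ ^ 2) * Y ^ 2 := by rw [hu]; ring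
      _ ≤ 2 * (exp 1 * ψ * (2 * τ * ψ * Q') ^ 2 * Φ * τ ^ 2) * (2 * (ι₁ ^ 2 * lam) + 2 * Y₀ ^ 2) :=
          mul_le_mul_of_nonneg_left hsq (by positivity)
      _ = (16 * exp 1 * ψ * (2 * τ * ψ * Q') ^ 2 * Φ * τ ^ 2 * ι₁ ^ 2 * lam) / 4 +
            (16 * exp 1 * ψ * (2 * τ * ψ * Q') ^ 2 * Φ * τ ^ 2 * Y₀ ^ 2) / 4 := by ring
      _ ≤ A * Q ^ 3 / 4 + A * Q ^ 3 / 4 := by linarith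
      _ = A * Q ^ 3 / 2 := by ring
  linarith

/-- **The six λ-dependent side conditions of the kit at once** (`hx₁ ∧ hx₂ ∧ hx₃ ∧ hy ∧ hθ ∧ hclose` of `towerBorn_le_law_split` /
`towerBorn_le_law_tracks`, token-for-token) from the rows `(s0)–(s6)` and the amplitude rows `(N1) (N2)`. -/
theorem towerNumerics_side_of_rows (hσ : 0 ≤ σ) (hΦ : 0 ≤ Φ) (hψ : 0 ≤ ψ) (hτ : 0 ≤ τ) (hA' : 0 ≤ A') (hQ' : 0 ≤ Q')
    (hι₁ : 0 ≤ ι₁) (hι₂ : 0 ≤ ι₂) (hι₃ : 0 ≤ ι₃) (hlam : 0 ≤ lam) (s0 : lam ≤ 1)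
    (s1 : 8 * σ * Q' * lam ≤ 1) (s2 : 2 * exp 1 * τ * Q' * lam ≤ 1) (s3 : 4 * Φ * τ * ι₁ * lam ≤ 1)
    (s4 : Φ * (exp 1 * τ * ι₁ + (exp 1 * τ) ^ 2 * ι₂ + (exp 1 * τ) ^ 3 * ι₃ + A' * (exp 1 * τ * Q') ^ 2 / 2) * lam ≤ 1 / 2)
    (s5 : 16 * σ * Q' * A' * (4 * Q') ^ 3 * lam ≤ A * Q ^ 3)
    (s6 : 16 * exp 1 * ψ * (2 * τ * ψ * Q') ^ 2 * Φ * τ ^ 2 * ι₁ ^ 2 * lam ≤ A * Q ^ 3)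
    (N1 : Φ * (τ * (ι₂ / (2 * Q') + ι₃ / (4 * Q' ^ 2) + A' * Q' / 4)) ≤ 1 / 4)
    (N2 : 16 * exp 1 * ψ * (2 * τ * ψ * Q') ^ 2 * Φ * τ ^ 2 * (ι₂ / (2 * Q') + ι₃ / (4 * Q' ^ 2) + A' * Q' / 4) ^ 2 ≤ A * Q ^ 3) :
    4 * σ * lam * Q' < 1 ∧ 2 * lam * τ * Q' ≤ 1 ∧ exp 1 * τ * lam * Q' < 1 ∧
      Φ * (τ * (ι₁ * lam + ι₂ / (2 * Q') + ι₃ / (4 * Q' ^ 2) + A' * Q' / 4)) < 1 ∧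
      Φ * (exp 1 * τ * (ι₁ * lam) + (exp 1 * τ) ^ 2 * (ι₂ * lam) + (exp 1 * τ) ^ 3 * (ι₃ * lam ^ 2) +
        A' * (exp 1 * τ * Q') * ((exp 1 * τ * lam * Q') ^ 3 / (1 - exp 1 * τ * lam * Q'))) < 1 ∧
      A' * (4 * Q') ^ 3 * (4 * σ * lam * Q' / (1 - 4 * σ * lam * Q')) +
        exp 1 * ψ * (2 * τ * ψ * Q') ^ 2 * (τ * (ι₁ * lam + ι₂ / (2 * Q') + ι₃ / (4 * Q' ^ 2) + A' * Q' / 4)) *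
          (Φ * (τ * (ι₁ * lam + ι₂ / (2 * Q') + ι₃ / (4 * Q' ^ 2) + A' * Q' / 4)) /
            (1 - Φ * (τ * (ι₁ * lam + ι₂ / (2 * Q') + ι₃ / (4 * Q' ^ 2) + A' * Q' / 4)))) ≤ A * Q ^ 3 :=
  ⟨towerNumerics_hx₁ s1, towerNumerics_hx₂ hτ hQ' hlam s2, towerNumerics_hx₃ s2, towerNumerics_hy s3 N1,
    towerNumerics_hθ hΦ hτ hA' hQ' hι₃ hlam s0 s2 s4,
    towerNumerics_hclose hσ hΦ hψ hτ hA' hQ' hι₁ hι₂ hι₃ hlam s0 s1 s3 s5 s6 N1 N2⟩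

end Rows

/-! ## §4 ONE explicit λ-threshold -/

section Threshold

variable {σ Φ ψ τ A A' Q Q' ι₁ ι₂ ι₃ lam : ℝ}

/-- **The threshold is positive** (for `A·Q³ > 0`): every entry of the `min`-chain is a positive closed form. -/
theorem towerNumerics_threshold_pos (hσ : 0 ≤ σ) (hΦ : 0 ≤ Φ) (hψ : 0 ≤ ψ) (hτ : 0 ≤ τ) (hA' : 0 ≤ A') (hQ' : 0 ≤ Q')
    (hι₁ : 0 ≤ ι₁) (hι₂ : 0 ≤ ι₂) (hι₃ : 0 ≤ ι₃) (hAQ : 0 < A * Q ^ 3) :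
    0 < min 1 (min (1 / (8 * σ * Q' + 1)) (min (1 / (2 * exp 1 * τ * Q' + 1)) (min (1 / (4 * Φ * τ * ι₁ + 1))
      (min (1 / (2 * (Φ * (exp 1 * τ * ι₁ + (exp 1 * τ) ^ 2 * ι₂ + (exp 1 * τ) ^ 3 * ι₃ + A' * (exp 1 * τ * Q') ^ 2 / 2)) + 1))
        (min (A * Q ^ 3 / (16 * σ * Q' * A' * (4 * Q') ^ 3 + A * Q ^ 3))
          (A * Q ^ 3 / (16 * exp 1 * ψ * (2 * τ * ψ * Q') ^ 2 * Φ * τ ^ 2 * ι₁ ^ 2 + A * Q ^ 3))))))) := by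
  refine lt_min one_pos (lt_min ?_ (lt_min ?_ (lt_min ?_ (lt_min ?_ (lt_min ?_ ?_))))) <;> positivity

/-- **Rows `(s0)–(s6)` from `λ ≤ threshold`.** -/
theorem towerNumerics_rows_of_lam_le (hσ : 0 ≤ σ) (hΦ : 0 ≤ Φ) (hψ : 0 ≤ ψ) (hτ : 0 ≤ τ) (hA' : 0 ≤ A') (hQ' : 0 ≤ Q')
    (hι₁ : 0 ≤ ι₁) (hι₂ : 0 ≤ ι₂) (hι₃ : 0 ≤ ι₃) (hAQ : 0 < A * Q ^ 3)
    (hle : lam ≤ min 1 (min (1 / (8 * σ * Q' + 1)) (min (1 / (2 * exp 1 * τ * Q' + 1)) (min (1 / (4 * Φ * τ * ι₁ + 1))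
      (min (1 / (2 * (Φ * (exp 1 * τ * ι₁ + (exp 1 * τ) ^ 2 * ι₂ + (exp 1 * τ) ^ 3 * ι₃ + A' * (exp 1 * τ * Q') ^ 2 / 2)) + 1))
        (min (A * Q ^ 3 / (16 * σ * Q' * A' * (4 * Q') ^ 3 + A * Q ^ 3))
          (A * Q ^ 3 / (16 * exp 1 * ψ * (2 * τ * ψ * Q') ^ 2 * Φ * τ ^ 2 * ι₁ ^ 2 + A * Q ^ 3)))))))) :
    lam ≤ 1 ∧ 8 * σ * Q' * lam ≤ 1 ∧ 2 * exp 1 * τ * Q' * lam ≤ 1 ∧ 4 * Φ * τ * ι₁ * lam ≤ 1 ∧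
      Φ * (exp 1 * τ * ι₁ + (exp 1 * τ) ^ 2 * ι₂ + (exp 1 * τ) ^ 3 * ι₃ + A' * (exp 1 * τ * Q') ^ 2 / 2) * lam ≤ 1 / 2 ∧
      16 * σ * Q' * A' * (4 * Q') ^ 3 * lam ≤ A * Q ^ 3 ∧
      16 * exp 1 * ψ * (2 * τ * ψ * Q') ^ 2 * Φ * τ ^ 2 * ι₁ ^ 2 * lam ≤ A * Q ^ 3 := by
  simp only [le_min_iff] at hle
  obtain ⟨h0, h1, h2, h3, h4, h5, h6⟩ := hle
  refine ⟨h0, ?_, ?_, ?_, ?_, ?_, ?_⟩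
  · exact towerNumerics_mul_le_of_le_div (by positivity) one_pos (by simpa using h1)
  · exact towerNumerics_mul_le_of_le_div (by positivity) one_pos (by simpa using h2)
  · exact towerNumerics_mul_le_of_le_div (by positivity) one_pos (by simpa using h3)
  · have h := towerNumerics_mul_le_of_le_div (a := 2 * (Φ * (exp 1 * τ * ι₁ + (exp 1 * τ) ^ 2 * ι₂ + (exp 1 * τ) ^ 3 * ι₃ +
        A' * (exp 1 * τ * Q') ^ 2 / 2))) (by positivity) one_pos (by simpa using h4)
    linarith
  · exact towerNumerics_mul_le_of_le_div (by positivity) hAQ h5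
  · exact towerNumerics_mul_le_of_le_div (by positivity) hAQ h6

/-- **MASTER FORM — the kit's six λ-dependent side conditions from the two amplitude rows and `λ ≤ threshold`.**  With §1 (`Q'`-rows from the
blocking row) and the definitional `A'`, `ι₃`, this is every numerical hypothesis of `towerBorn_le_law_split` / `towerBorn_le_law_tracks`. -/
theorem towerNumerics_side_of_lam_le (hσ : 0 ≤ σ) (hΦ : 0 ≤ Φ) (hψ : 0 ≤ ψ) (hτ : 0 ≤ τ) (hA' : 0 ≤ A') (hQ' : 0 ≤ Q')
    (hι₁ : 0 ≤ ι₁) (hι₂ : 0 ≤ ι₂) (hι₃ : 0 ≤ ι₃) (hAQ : 0 < A * Q ^ 3) (hlam : 0 ≤ lam)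
    (hle : lam ≤ min 1 (min (1 / (8 * σ * Q' + 1)) (min (1 / (2 * exp 1 * τ * Q' + 1)) (min (1 / (4 * Φ * τ * ι₁ + 1))
      (min (1 / (2 * (Φ * (exp 1 * τ * ι₁ + (exp 1 * τ) ^ 2 * ι₂ + (exp 1 * τ) ^ 3 * ι₃ + A' * (exp 1 * τ * Q') ^ 2 / 2)) + 1))
        (min (A * Q ^ 3 / (16 * σ * Q' * A' * (4 * Q') ^ 3 + A * Q ^ 3))
          (A * Q ^ 3 / (16 * exp 1 * ψ * (2 * τ * ψ * Q') ^ 2 * Φ * τ ^ 2 * ι₁ ^ 2 + A * Q ^ 3))))))))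
    (N1 : Φ * (τ * (ι₂ / (2 * Q') + ι₃ / (4 * Q' ^ 2) + A' * Q' / 4)) ≤ 1 / 4)
    (N2 : 16 * exp 1 * ψ * (2 * τ * ψ * Q') ^ 2 * Φ * τ ^ 2 * (ι₂ / (2 * Q') + ι₃ / (4 * Q' ^ 2) + A' * Q' / 4) ^ 2 ≤ A * Q ^ 3) :
    4 * σ * lam * Q' < 1 ∧ 2 * lam * τ * Q' ≤ 1 ∧ exp 1 * τ * lam * Q' < 1 ∧
      Φ * (τ * (ι₁ * lam + ι₂ / (2 * Q') + ι₃ / (4 * Q' ^ 2) + A' * Q' / 4)) < 1 ∧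
      Φ * (exp 1 * τ * (ι₁ * lam) + (exp 1 * τ) ^ 2 * (ι₂ * lam) + (exp 1 * τ) ^ 3 * (ι₃ * lam ^ 2) +
        A' * (exp 1 * τ * Q') * ((exp 1 * τ * lam * Q') ^ 3 / (1 - exp 1 * τ * lam * Q'))) < 1 ∧
      A' * (4 * Q') ^ 3 * (4 * σ * lam * Q' / (1 - 4 * σ * lam * Q')) +
        exp 1 * ψ * (2 * τ * ψ * Q') ^ 2 * (τ * (ι₁ * lam + ι₂ / (2 * Q') + ι₃ / (4 * Q' ^ 2) + A' * Q' / 4)) *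
          (Φ * (τ * (ι₁ * lam + ι₂ / (2 * Q') + ι₃ / (4 * Q' ^ 2) + A' * Q' / 4)) /
            (1 - Φ * (τ * (ι₁ * lam + ι₂ / (2 * Q') + ι₃ / (4 * Q' ^ 2) + A' * Q' / 4)))) ≤ A * Q ^ 3 := by
  obtain ⟨s0, s1, s2, s3, s4, s5, s6⟩ := towerNumerics_rows_of_lam_le hσ hΦ hψ hτ hA' hQ' hι₁ hι₂ hι₃ hAQ hle
  exact towerNumerics_side_of_rows hσ hΦ hψ hτ hA' hQ' hι₁ hι₂ hι₃ hlam s0 s1 s2 s3 s4 s5 s6 N1 N2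

end Threshold

/-! ## §5 The amplitude rows in the kit's forced parametrisation `A' = C_A·A`, `ι₃ = C₃·A·Q³`, `Q' = Q/ρ` -/

section Amplitude

variable {Φ ψ τ A Q ι₂ CA C3 ρ : ℝ}

/-- **The amplitude rows `(N1)`, `(N2)` from four one-line smallness rows.**  In the parametrisation the kit's own lower bounds force —
`A' := C_A·A` (`hA'ge`), `ι₃ := C₃·A·Q³` (`hι₃ge`), `Q' := Q/ρ` (§1, `ρ = max 4 (2τψ)`) — the λ-free part of `Y` is
`Y₀ = ρ·w/2 + K·X` with the import-to-scale ratio `w := ι₂/Q`, the amplitude `X := A·Q` and `K := C₃ρ²/4 + C_A/(4ρ)`; then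
`Φτρw ≤ 1/4`, `ΦτKX ≤ 1/8`, `64eψ³Φτ⁴w² ≤ X`, `256eψ³Φτ⁴K²X ≤ ρ²` give `(N1)` and `(N2)` (E1-TOWER-BLOCKED §4 (ii)–(iii): the amplitude is
free downward up to the `w²` floor; `w` is the import smallness). -/
theorem towerNumerics_amplitude_of_rows (hΦ : 0 ≤ Φ) (hψ : 0 ≤ ψ) (hQ : 0 < Q) (hρ : 0 < ρ) (hA : 0 ≤ A)
    (hι₂ : 0 ≤ ι₂) (hCA : 0 ≤ CA) (hC3 : 0 ≤ C3)
    (am1 : Φ * τ * ρ * (ι₂ / Q) ≤ 1 / 4)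
    (am2 : Φ * τ * (C3 * ρ ^ 2 / 4 + CA / (4 * ρ)) * (A * Q) ≤ 1 / 8)
    (am3 : 64 * exp 1 * ψ ^ 3 * Φ * τ ^ 4 * (ι₂ / Q) ^ 2 ≤ A * Q)
    (am4 : 256 * exp 1 * ψ ^ 3 * Φ * τ ^ 4 * (C3 * ρ ^ 2 / 4 + CA / (4 * ρ)) ^ 2 * (A * Q) ≤ ρ ^ 2) :
    Φ * (τ * (ι₂ / (2 * (Q / ρ)) + C3 * A * Q ^ 3 / (4 * (Q / ρ) ^ 2) + CA * A * (Q / ρ) / 4)) ≤ 1 / 4 ∧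
      16 * exp 1 * ψ * (2 * τ * ψ * (Q / ρ)) ^ 2 * Φ * τ ^ 2 *
        (ι₂ / (2 * (Q / ρ)) + C3 * A * Q ^ 3 / (4 * (Q / ρ) ^ 2) + CA * A * (Q / ρ) / 4) ^ 2 ≤ A * Q ^ 3 := by
  have hQ0 : Q ≠ 0 := hQ.ne'
  have hρ0 : ρ ≠ 0 := hρ.ne'
  set w := ι₂ / Q with hw
  set X := A * Q with hX
  set K := C3 * ρ ^ 2 / 4 + CA / (4 * ρ) with hK
  have hw0 : 0 ≤ w := by positivity
  have hX0 : 0 ≤ X := by positivity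
  have hK0 : 0 ≤ K := by positivity
  have hY₀ : ι₂ / (2 * (Q / ρ)) + C3 * A * Q ^ 3 / (4 * (Q / ρ) ^ 2) + CA * A * (Q / ρ) / 4 = ρ * w / 2 + K * X := by
    rw [hw, hX, hK]; field_simp; ring
  have hQ' : (2 * τ * ψ * (Q / ρ)) ^ 2 = 4 * τ ^ 2 * ψ ^ 2 * Q ^ 2 / ρ ^ 2 := by field_simp; ring
  rw [hY₀, hQ']
  constructor
  · have : Φ * (τ * (ρ * w / 2 + K * X)) = (Φ * τ * ρ * w) / 2 + Φ * τ * K * X := by ring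
    rw [this]; linarith
  · -- `(ρw/2 + KX)² ≤ ρ²w²/2 + 2K²X²`
    have hsq : (ρ * w / 2 + K * X) ^ 2 ≤ ρ ^ 2 * w ^ 2 / 2 + 2 * (K * X) ^ 2 := by nlinarith [sq_nonneg (ρ * w / 2 - K * X)]
    have hpre : 0 ≤ 16 * exp 1 * ψ * (4 * τ ^ 2 * ψ ^ 2 * Q ^ 2 / ρ ^ 2) * Φ * τ ^ 2 := by positivity
    calc 16 * exp 1 * ψ * (4 * τ ^ 2 * ψ ^ 2 * Q ^ 2 / ρ ^ 2) * Φ * τ ^ 2 * (ρ * w / 2 + K * X) ^ 2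
        ≤ 16 * exp 1 * ψ * (4 * τ ^ 2 * ψ ^ 2 * Q ^ 2 / ρ ^ 2) * Φ * τ ^ 2 * (ρ ^ 2 * w ^ 2 / 2 + 2 * (K * X) ^ 2) :=
          mul_le_mul_of_nonneg_left hsq hpre
      _ = (64 * exp 1 * ψ ^ 3 * Φ * τ ^ 4 * w ^ 2) * Q ^ 2 / 2 +
            (256 * exp 1 * ψ ^ 3 * Φ * τ ^ 4 * K ^ 2 * X) * X * Q ^ 2 / (2 * ρ ^ 2) := by
          field_simp; ring
      _ ≤ X * Q ^ 2 / 2 + ρ ^ 2 * X * Q ^ 2 / (2 * ρ ^ 2) := by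
          have hQ2 : 0 ≤ Q ^ 2 := sq_nonneg Q
          have h1 : (64 * exp 1 * ψ ^ 3 * Φ * τ ^ 4 * w ^ 2) * Q ^ 2 ≤ X * Q ^ 2 := mul_le_mul_of_nonneg_right am3 hQ2
          have h2 : (256 * exp 1 * ψ ^ 3 * Φ * τ ^ 4 * K ^ 2 * X) * X * Q ^ 2 ≤ ρ ^ 2 * X * Q ^ 2 := by
            have := mul_le_mul_of_nonneg_right (mul_le_mul_of_nonneg_right am4 hX0) hQ2
            simpa [mul_assoc] using this
          have hρ2 : 0 < 2 * ρ ^ 2 := by positivity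
          gcongr
      _ = A * Q ^ 3 := by rw [hX]; field_simp; ring

end Amplitude

end Summit.HubbardSuperconductivity.HubbardSuperconductivity.Theorems.EngineV8

end
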